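import Mathlib

/-!
# `BalabanUV.Beta.FP.DeperiodisationVanishing` — road «FP» for binder row D1, design «ROUTE T» row **(T-VAN)** (owner, gen 16): A SUMMABLE LATTICE FUNCTION
# IS THE LIMIT OF ITS PERIODISATIONS — `Σ'_t f(z + M•t) → f z` as `M → ∞` — hence a summable kernel all of whose large periodisations vanish (or tend to `0`) VANISHES

HONEST DEPENDENCY (page 1, mandatory): continuum YM on T⁴ ⇐ BetaPertH ∧ nine spine estimates (0/9 proved); BetaPertH ⇐ (D1) ∧ (D4) ∧ CAP+tail;
G-an2-4 gates asym, D1 and NE2/3/4.  HONEST FRAMING (cell contract, verbatim): «discharging `BetaPertH` makes Bałaban's UV stability UNCONDITIONAL —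
a real constructive-QFT result; it is NOT the continuum limit and NOT the Clay problem.»  THIS MODULE is [folklore] elementary analysis of absolutely convergent
lattice sums (Mathlib's `tendsto_tsum_compl_atTop_zero`, `Summable.tsum_le_tsum_of_inj`, `squeeze_zero_norm'`); no `def`, no `def … : Prop`, nothing cited, 0 sorry; 0∕4
row-D1 binders; NOT (T-PER), NOT SDF, NOT D1, NOT BetaPertH, NOT continuum, NOT Clay.  «not in print; our bookkeeping».

ABSOLUTE RULE (cell charter, verbatim): «No internally-minted statement may enter as a cited fact. Every hypothesis is either kernel-proved in this package or a
verbatim quotation of a PUBLISHED theorem with page reference. The manuscript(s) under audit are NOT citable for their own disputed steps — they are the thing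
under adjudication; programme-internal (2001/route/tribunal) claims are never citable.»

WHY (design ROUTE T, journal [D1P3-G16-ROUTE-T]; memo `N2B-DESIGN.md` §17).  ROUTE T proves the (STEP) door's kernel identity on every torus of side `M` (periodisation is
an algebra homomorphism, `GAN24/KernelPeriodisation`; the factorisation is exact for finite matrices, `FP/NestedStepLawMovingBorder` ∕ `FP/NestedStepLawSliced`) and then
DE-PERIODISES: each torus word is the `Mℤ^{d+1}`-periodisation of the corresponding ℤ^{d+1} word up to a wrap-around error `→ 0`, so the ℤ^{d+1} defect kernel `D` has
periodisations tending to `0`; by THIS FILE `Σ'_t D(z + M•t) → D z`, hence `D = 0`.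

CONTENTS ([folklore]; `n` = lattice dimension; index lattice `Fin n → ℤ`):
* `injective_translate_smul` — `t ↦ z + M•t` is injective for `M ≠ 0`; `not_mem_box_of_ne_zero` — for `t ≠ 0` and `1 ≤ M` the point `z + M•t` lies outside the box
  `Π_i (z_i − M, z_i + M)`; `tendsto_box_atTop` — the boxes exhaust the lattice.
* **`tendsto_tsum_translate_smul`** — for summable `f : (Fin n → ℤ) → ℝ` and every `z`: `Tendsto (M ↦ Σ'_t f (z + M•t)) atTop (𝓝 (f z))`.
* **`eq_of_tendsto_periodisation`** — if moreover `Σ'_t f (z + M•t) → c` then `f z = c`; in particular (`c = 0`) a summable kernel whose periodisations tend to `0` at `z` vanishes at `z`.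
Provenance: road FP OWNER b2b-balaban-beta-d1-p3 gen 16 (prover-b2b-balaban-beta-d1-p3-g16-0), 2026-08-21; design ROUTE T row (T-VAN).
-/

noncomputable section

namespace Summit.QuantumFields.BalabanUV.Beta.FP.DeperiodisationVanishing

open Filter Topology Finset
open scoped BigOperators

variable {n : ℕ}

/-- [folklore] Translation by a non-zero multiple of a lattice vector is injective: `t ↦ z + M•t`. -/
theorem injective_translate_smul (z : Fin n → ℤ) {M : ℤ} (hM : M ≠ 0) :
    Function.Injective fun t : Fin n → ℤ => z + M • t := by
  intro t t' h
  have h' : M • t = M • t' := add_left_cancel h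
  funext i
  have hi := congrArg (fun v => v i) h'
  simp only [Pi.smul_apply, smul_eq_mul] at hi
  exact mul_left_cancel₀ hM hi

/-- [our notation-free helper] The finite box of half-width `M` around `z`. -/
def box (z : Fin n → ℤ) (M : ℕ) : Finset (Fin n → ℤ) :=
  Fintype.piFinset fun i => Finset.Ioo (z i - M) (z i + M)

/-- [folklore] For `t ≠ 0` and `1 ≤ M`, `z + M•t` is NOT in the box of half-width `M` around `z`. -/
theorem not_mem_box_of_ne_zero (z : Fin n → ℤ) {M : ℕ} {t : Fin n → ℤ} (ht : t ≠ 0) :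
    z + (M : ℤ) • t ∉ box z M := by
  obtain ⟨i, hi⟩ : ∃ i, t i ≠ 0 := by
    by_contra h
    exact ht (funext fun i => by by_contra hc; exact h ⟨i, hc⟩)
  intro hmem
  have hi' := Fintype.mem_piFinset.mp hmem i
  simp only [Pi.add_apply, Pi.smul_apply, smul_eq_mul, Finset.mem_Ioo] at hi'
  rcases lt_or_gt_of_ne hi with hneg | hpos
  · have : (M : ℤ) * t i ≤ -(M : ℤ) := by nlinarith
    linarith [hi'.1]
  · have : (M : ℤ) ≤ (M : ℤ) * t i := by nlinarith
    linarith [hi'.2]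

/-- [folklore] The boxes exhaust the lattice. -/
theorem tendsto_box_atTop (z : Fin n → ℤ) : Tendsto (box z) atTop atTop := by
  refine tendsto_atTop_finset_of_monotone (fun M M' hMM' => ?_) (fun w => ?_)
  · intro w hw
    refine Fintype.mem_piFinset.mpr fun i => ?_
    have hi := Fintype.mem_piFinset.mp hw i
    simp only [Finset.mem_Ioo] at hi ⊢
    have : (M : ℤ) ≤ M' := by exact_mod_cast hMM'
    constructor <;> linarith [hi.1, hi.2]
  · refine ⟨(Finset.univ.sup fun i => (w i - z i).natAbs) + 1, Fintype.mem_piFinset.mpr fun i => ?_⟩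
    simp only [Finset.mem_Ioo]
    have h1 : (w i - z i).natAbs ≤ Finset.univ.sup fun i => (w i - z i).natAbs :=
      Finset.le_sup (f := fun i => (w i - z i).natAbs) (Finset.mem_univ i)
    have h2 : ((w i - z i).natAbs : ℤ) ≤ ((Finset.univ.sup fun i => (w i - z i).natAbs : ℕ) : ℤ) := by exact_mod_cast h1
    have h3 : w i - z i ≤ ((w i - z i).natAbs : ℤ) := Int.le_natAbs
    have h4 : -(w i - z i) ≤ ((w i - z i).natAbs : ℤ) := by
      have := Int.le_natAbs (a := -(w i - z i)); rwa [Int.natAbs_neg] at this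
    push_cast
    constructor <;> omega

/-- [folklore] **A SUMMABLE LATTICE FUNCTION IS THE LIMIT OF ITS PERIODISATIONS**: `Σ'_t f(z + M•t) → f z` as `M → ∞`. -/
theorem tendsto_tsum_translate_smul {f : (Fin n → ℤ) → ℝ} (hf : Summable f) (z : Fin n → ℤ) :
    Tendsto (fun M : ℕ => ∑' t : Fin n → ℤ, f (z + (M : ℤ) • t)) atTop (𝓝 (f z)) := by
  classical
  have habs : Summable fun w => |f w| := hf.abs
  -- the tail of `|f|` outside the box tends to zero
  have htail : Tendsto (fun M : ℕ => ∑' w : { w // w ∉ box z M }, |f w|) atTop (𝓝 0) :=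
    (tendsto_tsum_compl_atTop_zero fun w => |f w|).comp (tendsto_box_atTop z)
  -- `Σ' t, f(z + M t) - f z → 0` by the tail bound, for `M ≥ 1`
  have key : Tendsto (fun M : ℕ => ∑' t : Fin n → ℤ, f (z + (M : ℤ) • t) - f z) atTop (𝓝 0) := by
    refine squeeze_zero_norm' ?_ htail
    filter_upwards [eventually_ge_atTop 1] with M hM
    have hM0 : (M : ℤ) ≠ 0 := by exact_mod_cast (Nat.one_le_iff_ne_zero.mp hM)
    have hinj := injective_translate_smul z hM0
    set g : (Fin n → ℤ) → ℝ := fun t => f (z + (M : ℤ) • t) with hg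
    have hgs : Summable g := hf.comp_injective hinj
    -- split off `t = 0`
    have hsplit : ∑' t, g t = g 0 + ∑' t, ite (t = 0) 0 (g t) := hgs.tsum_eq_add_tsum_ite 0
    have hg0 : g 0 = f z := by simp [hg]
    -- the remainder is dominated by the tail of `|f|` outside the box
    set k : (Fin n → ℤ) → ℝ := fun w => if w ∈ box z M then 0 else |f w| with hk
    have hk_nonneg : ∀ w, 0 ≤ k w := fun w => by simp only [hk]; split_ifs <;> simp [abs_nonneg]
    have hk_le : ∀ w, k w ≤ |f w| := fun w => by simp only [hk]; split_ifs <;> simp [abs_nonneg]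
    have hks : Summable k := Summable.of_nonneg_of_le hk_nonneg hk_le habs
    have hrem_s : Summable fun t => ite (t = 0) (0 : ℝ) (g t) := by
      refine Summable.of_norm_bounded (g := fun t => |g t|) hgs.abs fun t => ?_
      split_ifs <;> simp [abs_nonneg]
    have hrem_abs_s : Summable fun t => |ite (t = 0) (0 : ℝ) (g t)| := hrem_s.abs
    have hbound : |∑' t, ite (t = 0) (0 : ℝ) (g t)| ≤ ∑' w, k w := by
      have habs_le : |∑' t, ite (t = 0) (0 : ℝ) (g t)| ≤ ∑' t, |ite (t = 0) (0 : ℝ) (g t)| := by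
        have := norm_tsum_le_tsum_norm (f := fun t => ite (t = 0) (0 : ℝ) (g t)) (by simpa only [Real.norm_eq_abs] using hrem_abs_s)
        simpa only [Real.norm_eq_abs] using this
      refine habs_le.trans ?_
      refine Summable.tsum_le_tsum_of_inj (fun t => z + (M : ℤ) • t) hinj (fun c _ => hk_nonneg c) (fun t => ?_) hrem_abs_s hks
      by_cases ht : t = 0
      · simp [ht, hk_nonneg]
      · have hout := not_mem_box_of_ne_zero z (M := M) ht
        rw [if_neg ht]
        show |f (z + (M : ℤ) • t)| ≤ k (z + (M : ℤ) • t)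
        have hkv : k (z + (M : ℤ) • t) = |f (z + (M : ℤ) • t)| := by simp only [hk]; rw [if_neg hout]
        rw [hkv]
    have hk_tsum : ∑' w, k w = ∑' w : { w // w ∉ box z M }, |f w| := by
      have hsub : ∑' w : { w // w ∉ box z M }, |f w| = ∑' w, ((↑(box z M) : Set (Fin n → ℤ))ᶜ).indicator (fun w => |f w|) w :=
        _root_.tsum_subtype ((↑(box z M) : Set (Fin n → ℤ))ᶜ) (fun w => |f w|)
      rw [hsub]
      refine tsum_congr fun w => ?_
      simp only [hk, Set.indicator_apply, Set.mem_compl_iff, Finset.mem_coe]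
      by_cases h1 : w ∈ box z M
      · rw [if_pos h1, if_neg (not_not.mpr h1)]
      · rw [if_neg h1, if_pos h1]
    calc ‖∑' t, f (z + (M : ℤ) • t) - f z‖ = |∑' t, ite (t = 0) (0 : ℝ) (g t)| := by
          rw [Real.norm_eq_abs]
          change |∑' t, g t - f z| = _
          rw [hsplit, hg0]; ring_nf
      _ ≤ ∑' w : { w // w ∉ box z M }, |f w| := hbound.trans_eq hk_tsum
  have h2 := key.add_const (f z)
  simp only [zero_add, sub_add_cancel] at h2
  exact h2

/-- [folklore] **DE-PERIODISATION**: if `f` is summable and its periodisations at `z` tend to `c`, then `f z = c`.  With `c = 0`: a summable kernel all of whose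
(large) periodisations vanish at `z` — or tend to `0` — vanishes at `z`. -/
theorem eq_of_tendsto_periodisation {f : (Fin n → ℤ) → ℝ} (hf : Summable f) (z : Fin n → ℤ) {c : ℝ}
    (hc : Tendsto (fun M : ℕ => ∑' t : Fin n → ℤ, f (z + (M : ℤ) • t)) atTop (𝓝 c)) : f z = c :=
  tendsto_nhds_unique (tendsto_tsum_translate_smul hf z) hc

end Summit.QuantumFields.BalabanUV.Beta.FP.DeperiodisationVanishing

end
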